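import Summits.FinalStateConjecture.FinalStateConjecture.Theorems.StarvedNecksNecksCertifyStubSeamSurgeryRide
import Literature.Geometry.Lorentzian.CausalityPushUp


/-!
# Route StarvedNecks — crux `NecksCertify`, line `two-cap-focusing-ledger`: seam surgery, the exterior region

Helper file for the registered stub `stub_seamSurgery` (N2): `O = exteriorOf 𝒟 d₂.charted` for the
seamed decomposition — every point of `O` is causally below its late charted region (`reach_charted`,
from A13 at the thresholds `(T + 1, τ₁ + 5/2 + sⱼ)` and `upward`), and then the exterior region
`J⁺(ι X) ∩ I⁻(charted)` is the same for the old and the new charts (`stub_seamSurgery_exterior`,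
registered helper sub-goal = `exterior_congr`: push-up and transitivity of `≪`).

References: B. O'Neill, *Semi-Riemannian geometry*, Academic Press 1983, Ch. 14, Cor. 14.1,
pp. 402–403.  Mathlib + the landed `…StubSeamSurgeryRide` module and
`Literature.Geometry.Lorentzian.CausalityPushUp`; no definitions, no named facts.
-/

noncomputable section

open scoped Manifold ContDiff Topology ENNReal
open Filter Set Function Topology Literature.Geometry.Lorentzian

namespace Summit.FinalStateConjecture.FinalStateConjecture.Theorems.NecksCertifyTwoCap.Seam

set_option linter.dupNamespace false

open Summit.FinalStateConjecture.FinalStateConjecture.Theorems.SeamedChartsExhaust.WideAnchoring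
  (radius_add_smul_e₀ poincareInv_add_smul causalPast_trans)
open Summit.FinalStateConjecture.FinalStateConjecture.Theorems.SeamedChartsExhaust.Negative
  (line_mem_causalFuture)

/-- **Every point of `O` is causally below the late charted region of the seamed decomposition.**
Given clause A13 at the compatible thresholds `(T + 1, τ₁ + 5/2 + sⱼ)`: a point of `O` is either a
late flat point outside the tubes (charted), or a late point of a re-gauged chart (below the charted
region by `upward`), or below the A13 slabs, whose points are charted flat points or, again by
`upward`, below the charted region.  O'Neill 1983, Ch. 14, pp. 402–403. [folklore] -/
theorem reach_charted {𝓢 : Spacetime.{0} 4} (N : ℕ) (Λ : Fin N → lorentzGroup) (c : Fin N → E4) (M a : Fin N → ℝ) (R₁ τ₁ τf T : ℝ) (s : Fin N → ℝ)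
    (hs : ∀ j, 0 ≤ s j) (hτ : τf ≤ τ₁) (hT : τ₁ + 3 ≤ T)
    (hdomeq : ∀ j (y y' : E4), (boostedKerrBackground (Λ j) (c j) (M j) (a j)).radius y' = (boostedKerrBackground (Λ j) (c j) (M j) (a j)).radius y → y ∈ (boostedKerrBackground (Λ j) (c j) (M j) (a j)).domain → y' ∈ (boostedKerrBackground (Λ j) (c j) (M j) (a j)).domain)
    (Rg : Fin N → ℝ → ℝ) (hRgm : ∀ j, Monotone (Rg j)) (hRgc : ∀ j, Continuous (Rg j))
    (hRg4 : ∀ j t, R₁ + 4 ≤ Rg j t)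
    (b : Fin N → ℝ → ℝ) (hbRg : ∀ j t, Rg j t + 21 / 20 ≤ b j t ∧ b j t ≤ Rg j t + 29 / 20)
    (Ψ Ψ' Gl : ∀ j, (boostedKerrBackground (Λ j) (c j) (M j) (a j)).domain → 𝓢.carrier)
    (hA1a : ∀ j, ContMDiffOn 𝓘(ℝ, E4) (𝓡 4) ∞ (Ψ' j)
      {x | τ₁ < (boostedKerrBackground (Λ j) (c j) (M j) (a j)).time x ∧ (boostedKerrBackground (Λ j) (c j) (M j) (a j)).radius x < Rg j ((boostedKerrBackground (Λ j) (c j) (M j) (a j)).time x) + 2})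
    (hA2 : ∀ j (x : (boostedKerrBackground (Λ j) (c j) (M j) (a j)).domain), (boostedKerrBackground (Λ j) (c j) (M j) (a j)).radius x ≤ R₁ + 1 → Ψ' j x = Ψ j x)
    (hA8 : ∀ j (x : (boostedKerrBackground (Λ j) (c j) (M j) (a j)).domain), τ₁ ≤ (boostedKerrBackground (Λ j) (c j) (M j) (a j)).time x → R₁ ≤ (boostedKerrBackground (Λ j) (c j) (M j) (a j)).radius x →
      (boostedKerrBackground (Λ j) (c j) (M j) (a j)).radius x ≤ Rg j ((boostedKerrBackground (Λ j) (c j) (M j) (a j)).time x) + 2 →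
      𝓢.timeOrientation.IsFutureDirected
        (mfderiv 𝓘(ℝ, E4) (𝓡 4) (Ψ' j) x ((Λ j : E4 ≃L[ℝ] E4) (E4.basisVector 0))))
    (hHc2 : ∀ j (ϱ τ₂ : ℝ), R₁ ≤ ϱ → τf < τ₂ →
      Ψ j '' {x | τf < (boostedKerrBackground (Λ j) (c j) (M j) (a j)).time x ∧ (boostedKerrBackground (Λ j) (c j) (M j) (a j)).time x < τ₂ ∧ (boostedKerrBackground (Λ j) (c j) (M j) (a j)).radius x < ϱ} ⊆
        𝓢.metric.causalPast 𝓢.timeOrientation (Ψ j '' (boostedKerrBackground (Λ j) (c j) (M j) (a j)).truncTimeSlab ϱ τ₂))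
    (W₀ : TopologicalSpace.Opens E4) (Φ : W₀ → 𝓢.carrier) (P : E4 → Prop)
    (hA3 : ∀ j (y : E4) (hy : y ∈ (boostedKerrBackground (Λ j) (c j) (M j) (a j)).domain), τ₁ ≤ y 0 → P y →
      (boostedKerrBackground (Λ j) (c j) (M j) (a j)).radius y ≤ Rg j ((boostedKerrBackground (Λ j) (c j) (M j) (a j)).time y) + 2 → ∃ hw : y ∈ W₀, Ψ' j ⟨y, hy⟩ = Φ ⟨y, hw⟩)
    (hcollar : ∀ j (y : E4), y ∈ (boostedKerrBackground (Λ j) (c j) (M j) (a j)).domain → τ₁ + 1 + s j < (boostedKerrBackground (Λ j) (c j) (M j) (a j)).time y →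
      Rg j ((boostedKerrBackground (Λ j) (c j) (M j) (a j)).time y) + 17 / 20 < (boostedKerrBackground (Λ j) (c j) (M j) (a j)).radius y → (boostedKerrBackground (Λ j) (c j) (M j) (a j)).radius y < Rg j ((boostedKerrBackground (Λ j) (c j) (M j) (a j)).time y) + 2 →
      τ₁ ≤ y 0 ∧ τf < y 0 ∧ P y)
    (hGl2 : ∀ j (x : (boostedKerrBackground (Λ j) (c j) (M j) (a j)).domain), τ₁ + 2 + s j ≤ (boostedKerrBackground (Λ j) (c j) (M j) (a j)).time x → (boostedKerrBackground (Λ j) (c j) (M j) (a j)).radius x < b j ((boostedKerrBackground (Λ j) (c j) (M j) (a j)).time x) →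
      Gl j x = Ψ' j x)
    (hlag : ∀ j (y : E4), τ₁ ≤ (boostedKerrBackground (Λ j) (c j) (M j) (a j)).time y → (boostedKerrBackground (Λ j) (c j) (M j) (a j)).radius y ≤ Rg j ((boostedKerrBackground (Λ j) (c j) (M j) (a j)).time y) + 2 → (boostedKerrBackground (Λ j) (c j) (M j) (a j)).time y - s j ≤ y 0)
    (O : Set 𝓢.carrier)
    (hA13 : O \ (Φ '' {y : W₀ | T + 1 < y.1 0 ∧ P y.1} ∪
        ⋃ j, Ψ' j '' {x | τ₁ + 5 / 2 + s j < (boostedKerrBackground (Λ j) (c j) (M j) (a j)).time x ∧ (boostedKerrBackground (Λ j) (c j) (M j) (a j)).radius x < Rg j ((boostedKerrBackground (Λ j) (c j) (M j) (a j)).time x) + 2}) ⊆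
      𝓢.metric.causalPast 𝓢.timeOrientation (Φ '' {y : W₀ | y.1 0 = T + 1 ∧ P y.1} ∪
        ⋃ j, Ψ' j '' {x | (boostedKerrBackground (Λ j) (c j) (M j) (a j)).time x = τ₁ + 5 / 2 + s j ∧ (boostedKerrBackground (Λ j) (c j) (M j) (a j)).radius x < Rg j ((boostedKerrBackground (Λ j) (c j) (M j) (a j)).time x) + 2})) :
    O ⊆ 𝓢.metric.causalPast 𝓢.timeOrientation
        ((⋃ j, Gl j '' {x | T + s j < (boostedKerrBackground (Λ j) (c j) (M j) (a j)).time x}) ∪ Φ '' {y : W₀ | T < y.1 0 ∧ P y.1}) := by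
  intro q hqO
  set CH : Set 𝓢.carrier := (⋃ j, Gl j '' {x | T + s j < (boostedKerrBackground (Λ j) (c j) (M j) (a j)).time x}) ∪
    Φ '' {y : W₀ | T < y.1 0 ∧ P y.1} with hCH
  have hup : ∀ j (x : E4) (hx : x ∈ (boostedKerrBackground (Λ j) (c j) (M j) (a j)).domain), τ₁ + 2 + s j ≤ (boostedKerrBackground (Λ j) (c j) (M j) (a j)).time x →
      (boostedKerrBackground (Λ j) (c j) (M j) (a j)).radius x < Rg j ((boostedKerrBackground (Λ j) (c j) (M j) (a j)).time x) + 2 →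
      Ψ' j ⟨x, hx⟩ ∈ 𝓢.metric.causalPast 𝓢.timeOrientation CH := by
    intro j x hx h1 h2
    refine LorentzianMetric.causalFuture_mono ?_ (upward (Λ j) (c j) (M j) (a j) R₁ τ₁ (s j) τf T
      (hs j) hτ hT (hdomeq j) (Rg j) (hRgm j) (hRgc j) (hRg4 j) (b j) (hbRg j) (Ψ j) (Ψ' j) (Gl j)
      (hA1a j) (hA2 j) (hA8 j) (hHc2 j) W₀ Φ P (hA3 j) (hcollar j) (hGl2 j) (hlag j) x hx h1 h2)
    rintro w (⟨y, hy, rfl⟩ | ⟨y, hy, rfl⟩)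
    · exact Or.inl (mem_iUnion.mpr ⟨j, y, hy, rfl⟩)
    · exact Or.inr ⟨y, hy, rfl⟩
  by_cases hq1 : q ∈ Φ '' {y : W₀ | T + 1 < y.1 0 ∧ P y.1} ∪
      ⋃ j, Ψ' j '' {x | τ₁ + 5 / 2 + s j < (boostedKerrBackground (Λ j) (c j) (M j) (a j)).time x ∧ (boostedKerrBackground (Λ j) (c j) (M j) (a j)).radius x < Rg j ((boostedKerrBackground (Λ j) (c j) (M j) (a j)).time x) + 2}
  · rcases hq1 with ⟨y, ⟨hy0, hPy⟩, rfl⟩ | hq1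
    · exact LorentzianMetric.subset_causalPast _ _ _ (Or.inr ⟨y, ⟨by linarith, hPy⟩, rfl⟩)
    · obtain ⟨j, hj⟩ := mem_iUnion.mp hq1
      obtain ⟨x, ⟨hxt, hxr⟩, rfl⟩ := hj
      have hxt' : τ₁ + 5 / 2 + s j < (boostedKerrBackground (Λ j) (c j) (M j) (a j)).time x := hxt
      exact hup j x x.2 (by linarith) hxr
  · have hJ := hA13 ⟨hqO, hq1⟩
    have hJ' : q ∈ 𝓢.metric.causalFuture 𝓢.timeOrientation.reverse _ := hJ
    rw [LorentzianMetric.causalFuture_eq_biUnion] at hJ'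
    simp only [mem_iUnion, exists_prop] at hJ'
    obtain ⟨w, hw, hqw⟩ := hJ'
    refine causalPast_trans hqw ?_
    rcases hw with ⟨y, ⟨hy0, hPy⟩, rfl⟩ | hw
    · exact LorentzianMetric.subset_causalPast _ _ _ (Or.inr ⟨y, ⟨by rw [hy0]; linarith, hPy⟩, rfl⟩)
    · obtain ⟨j, hj⟩ := mem_iUnion.mp hw
      obtain ⟨x, ⟨hxt, hxr⟩, rfl⟩ := hj
      have hxt' : (boostedKerrBackground (Λ j) (c j) (M j) (a j)).time x = τ₁ + 5 / 2 + s j := hxt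
      exact hup j x x.2 (by linarith) hxr

/-- **The exterior determined by the charts is unchanged by the seam** (abstract form): if
`O = SF ∩ I⁻(CH₁)`, both charted regions lie in `O`, and every point of `O` is causally below `CH₂`,
then `O = SF ∩ I⁻(CH₂)` (push-up `x ≪ y ≤ z ⇒ x ≪ z`, O'Neill 1983, Cor. 14.1, and transitivity of
`≪`). [folklore] -/
theorem exterior_congr {𝓢 : Spacetime.{0} 4} (SF CH₁ CH₂ O : Set 𝓢.carrier)
    (hO : O = SF ∩ 𝓢.metric.chronologicalPast 𝓢.timeOrientation CH₁) (h₁ : CH₁ ⊆ O) (h₂ : CH₂ ⊆ O)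
    (hreach : O ⊆ 𝓢.metric.causalPast 𝓢.timeOrientation CH₂) :
    O = SF ∩ 𝓢.metric.chronologicalPast 𝓢.timeOrientation CH₂ := by
  have hn1 : (1 : WithTop ℕ∞) ≤ ((⊤ : ℕ∞) : WithTop ℕ∞) := WithTop.coe_le_coe.mpr le_top
  ext p
  constructor
  · intro hp
    have hp' := hp
    rw [hO] at hp'
    obtain ⟨hpS, hpI⟩ := hp'
    refine ⟨hpS, ?_⟩
    have hpI' : p ∈ 𝓢.metric.chronologicalFuture 𝓢.timeOrientation.reverse CH₁ := hpI
    rw [LorentzianMetric.chronologicalFuture_eq_biUnion] at hpI'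
    simp only [mem_iUnion, exists_prop] at hpI'
    obtain ⟨q, hq, hpq⟩ := hpI'
    have hqJ : q ∈ 𝓢.metric.causalFuture 𝓢.timeOrientation.reverse CH₂ := hreach (h₁ hq)
    rw [LorentzianMetric.causalFuture_eq_biUnion] at hqJ
    simp only [mem_iUnion, exists_prop] at hqJ
    obtain ⟨w, hw, hqw⟩ := hqJ
    show p ∈ 𝓢.metric.chronologicalFuture 𝓢.timeOrientation.reverse CH₂
    rw [LorentzianMetric.chronologicalFuture_eq_biUnion]
    simp only [mem_iUnion, exists_prop]
    exact ⟨w, hw, LorentzianMetric.mem_chronologicalFuture_of_mem_causalFuture hn1 hqw hpq⟩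
  · rintro ⟨hpS, hpI⟩
    rw [hO]
    refine ⟨hpS, ?_⟩
    -- `I⁻(CH₂) ⊆ I⁻(O) ⊆ I⁻(I⁻(CH₁)) ⊆ I⁻(CH₁)`
    have h3 : p ∈ 𝓢.metric.chronologicalFuture 𝓢.timeOrientation.reverse O :=
      LorentzianMetric.chronologicalFuture_mono h₂ hpI
    rw [LorentzianMetric.chronologicalFuture_eq_biUnion] at h3
    simp only [mem_iUnion, exists_prop] at h3
    obtain ⟨q, hq, hpq⟩ := h3
    rw [hO] at hq
    exact LorentzianMetric.mem_chronologicalFuture_trans hq.2 hpq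


/-- Registered helper sub-goal `stub_seamSurgery_exterior` of N2 (closed form of `exterior_congr`).
[folklore] -/
theorem stub_seamSurgery_exterior :
    ∀ (𝓢 : Spacetime.{0} 4) (SF CH₁ CH₂ O : Set 𝓢.carrier),
      O = SF ∩ 𝓢.metric.chronologicalPast 𝓢.timeOrientation CH₁ → CH₁ ⊆ O → CH₂ ⊆ O →
      O ⊆ 𝓢.metric.causalPast 𝓢.timeOrientation CH₂ →
      O = SF ∩ 𝓢.metric.chronologicalPast 𝓢.timeOrientation CH₂ :=
  fun _ SF CH₁ CH₂ O hO h₁ h₂ hr ↦ exterior_congr SF CH₁ CH₂ O hO h₁ h₂ hr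

end Summit.FinalStateConjecture.FinalStateConjecture.Theorems.NecksCertifyTwoCap.Seam

end
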